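import Mathlib.Algebra.Order.BigOperators.Group.Finset
import Mathlib.Algebra.BigOperators.Group.Finset.Piecewise
import Mathlib.Algebra.BigOperators.Ring.Finset
import Literature.Computability.Complexity.SymPlus
import HarnessLib

/-!
# Stub stub_levelset_bias_of_symPlus (line Sketch, crux CircuitNpAcc0)

The pigeonhole step of the Jacobi level-set road: let `S` be a `SYM⁺` term system on `n`
variables and `χ` a `{0, ±1}`-valued function on the cube whose slice `[χ = 1]` is constant on
every level set `L_v = {x | count_S x = v}` of the number of satisfied terms. On a level set
either `χ ≡ 1` (as soon as one point has `χ = 1`) or `χ ∈ {0, -1}` throughout, so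
`|Σ_{x ∈ L_v} χ x| = #{x ∈ L_v | χ x ≠ 0}` (`levelsetBias_abs_levelSum_eq`). Since
`count_S x ≤ size S`, the `size S + 1` level sets `v = 0, …, size S` exhaust the cube, whence
`#{χ ≠ 0} = Σ_{v ≤ size} |Σ_{L_v} χ|` (`levelsetBias_card_eq_sum_abs`), and by pigeonhole some
level set carries the bias `#{χ ≠ 0} ≤ |Σ_{L_v} χ| · (size S + 1)`
(`stub_levelset_bias_of_symPlus`). Elementary finite sums; sorry-free.
-/

set_option linter.dupNamespace false -- `Summit.PneNP.PneNP.…`: summit = sub-problem (D-0017)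

namespace Summit.PneNP.PneNP.Theorems.CircuitNpAcc0

open Finset Literature.Computability.Complexity

/-- **On a level set the character sum has no cancellation**: if `[χ = 1]` is constant on the
level sets of `count_S` and `χ ∈ {0, ±1}`, then on `L_v = {count_S = v}` either `χ ≡ 1` or
`χ ≤ 0`, so `|Σ_{x ∈ L_v} χ x|` is the number of `x ∈ L_v` with `χ x ≠ 0`. -/
theorem levelsetBias_abs_levelSum_eq {n : ℕ} (S : SymPlus n) (χ : (Fin n → Bool) → ℤ)
    (hχ : ∀ x, χ x = 0 ∨ χ x = 1 ∨ χ x = -1)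
    (hrep : ∀ x y, S.count x = S.count y → (χ x = 1 ↔ χ y = 1)) (v : ℕ) :
    |∑ x ∈ univ.filter (fun x => S.count x = v), χ x| =
      (((univ.filter fun x => χ x ≠ 0).filter fun x => S.count x = v).card : ℤ) := by
  rw [filter_comm, card_filter, Nat.cast_sum]
  by_cases h1 : ∃ x₀ ∈ univ.filter (fun x => S.count x = v), χ x₀ = 1
  · obtain ⟨x₀, hx₀, h₀⟩ := h1
    have hall : ∀ x ∈ univ.filter (fun x => S.count x = v), χ x = 1 := fun x hx =>
      (hrep x₀ x ((mem_filter.1 hx₀).2.trans (mem_filter.1 hx).2.symm)).1 h₀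
    rw [abs_sum_of_nonneg fun x hx => by rw [hall x hx]; exact zero_le_one]
    refine sum_congr rfl fun x hx => ?_
    rw [hall x hx, if_pos one_ne_zero, Nat.cast_one]
  · have hle : ∀ x ∈ univ.filter (fun x => S.count x = v), χ x ≤ 0 := fun x hx => by
      rcases hχ x with h | h | h
      · rw [h]
      · exact absurd ⟨x, hx, h⟩ h1
      · rw [h]
        norm_num
    rw [abs_of_nonpos (sum_nonpos hle), ← sum_neg_distrib]
    refine sum_congr rfl fun x hx => ?_
    rcases hχ x with h | h | h
    · rw [h]
      simp
    · exact absurd ⟨x, hx, h⟩ h1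
    · rw [h]
      simp

/-- **The level sets exhaust the cube**: `count_S ≤ size S`, so summing
`levelsetBias_abs_levelSum_eq` over `v = 0, …, size S` gives
`#{χ ≠ 0} = Σ_{v ≤ size S} |Σ_{count_S = v} χ|`. -/
theorem levelsetBias_card_eq_sum_abs {n : ℕ} (S : SymPlus n) (χ : (Fin n → Bool) → ℤ)
    (hχ : ∀ x, χ x = 0 ∨ χ x = 1 ∨ χ x = -1)
    (hrep : ∀ x y, S.count x = S.count y → (χ x = 1 ↔ χ y = 1)) :
    ((univ.filter fun x => χ x ≠ 0).card : ℤ) =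
      ∑ v ∈ range (S.size + 1), |∑ x ∈ univ.filter (fun x => S.count x = v), χ x| := by
  have hmaps : ((univ.filter fun x => χ x ≠ 0 : Finset (Fin n → Bool)) : Set (Fin n → Bool)).MapsTo
      S.count (range (S.size + 1) : Finset ℕ) := fun x _ =>
    mem_coe.2 (mem_range.2 (Nat.lt_succ_of_le (S.count_le_size x)))
  rw [card_eq_sum_card_fiberwise hmaps, Nat.cast_sum]
  exact sum_congr rfl fun v _ => (levelsetBias_abs_levelSum_eq S χ hχ hrep v).symm

/-- **Pigeonhole over level sets** (stub `stub_levelset_bias_of_symPlus` of line Sketch, crux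
`CircuitNpAcc0`): if a `{0, ±1}`-valued `χ` has `[χ = 1]` constant on every level set of
`count_S`, then some level set has `#{χ ≠ 0} ≤ |Σ_{count_S = v} χ| · (size S + 1)` — the
`size S + 1` values `|Σ_{L_v} χ|`, `v ≤ size S`, sum to `#{χ ≠ 0}`
(`levelsetBias_card_eq_sum_abs`), so the largest is at least the mean. -/
theorem stub_levelset_bias_of_symPlus {n : ℕ} (S : SymPlus n) (χ : (Fin n → Bool) → ℤ)
    (hχ : ∀ x, χ x = 0 ∨ χ x = 1 ∨ χ x = -1)
    (hrep : ∀ x y, S.count x = S.count y → (χ x = 1 ↔ χ y = 1)) :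
    ∃ v : ℕ, ((univ.filter fun x => χ x ≠ 0).card : ℤ) ≤
      |∑ x ∈ univ.filter (fun x => S.count x = v), χ x| * ((S.size : ℤ) + 1) := by
  have hdecomp := levelsetBias_card_eq_sum_abs S χ hχ hrep
  obtain ⟨v, -, hv⟩ := exists_le_of_sum_le (nonempty_range_add_one (n := S.size))
    (f := fun _ => ((univ.filter fun x => χ x ≠ 0).card : ℤ))
    (g := fun v => |∑ x ∈ univ.filter (fun x => S.count x = v), χ x| * ((S.size : ℤ) + 1))
    (by
      rw [← sum_mul, ← hdecomp, sum_const, card_range, nsmul_eq_mul]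
      push_cast
      exact (mul_comm _ _).le)
  exact ⟨v, hv⟩

end Summit.PneNP.PneNP.Theorems.CircuitNpAcc0
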